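import Mathlib

/-!
# Residual renormalisation of q-type diagrams: one closed form for the non-starred coefficients
(venture QEDPrecision, cell `pub-qed`, integrand seat int-1, gen 13)

HONEST FRAMING (verbatim, venture QEDPrecision): independent recomputation; certified where stated,
statistical where stated; no new-physics claim.

## What this file is

In the AHKN scheme (K-operation for UV, R/I-subtraction for IR) the contribution `A₁^{(2N)}[q-type]` of the
diagrams WITHOUT lepton loops (2N = 10: "Set V") is assembled from the finite, fully subtracted magnetic
moments `ΔM_{2n}` of the self-energy-like words and finite parts of renormalisation constants by a RESIDUAL
RENORMALISATION FORMULA that is derived and printed order by order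
[AHKN, Phys. Rev. D 77, 053012 (2008) = arXiv:0712.2607: App. A, source labels `a4_qtype` / `a6_result`
 (orders 4, 6), and the display labelled `a8_Residual_formula` in the BODY's concluding section (arXiv PDF p. 15;
 order 8 — NOT App. B, corrected 2026-08-20 after referee finding ref-2 r65 N-1);
 AHKN, Phys. Rev. D 91, 033006 (2015) = arXiv:1412.8284, eq. (35) p. 14 and App. B eqs. (B14)–(B15) (order 10)].
Write `dM n` for `ΔM_{2n}` (with `ΔM₂ := M₂ = 1/2`: nothing is subtracted at second order) and `x j` for `ΔLB_{2j}`,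
the papers' COMBINED finite vertex-plus-wave-function renormalisation constant of order `2j` EXACTLY AS DEFINED
THERE — `ΔLB₂ = ΔL₂ + ΔB₂ = ΔB₂` (`ΔL₂ = 0`) and `ΔLB₄ = ΔL₄ + ΔB₄`, but a COMPOSITE from order 6 on:
arXiv:0712.2607 display `LB_6`, `ΔLB^{(6)} = ΔL^{(6)} + ΔB^{(6)} + ΔL^{(4)} ΔB₂ + Δδm^{(4)} B_{2*}[I]`, and
arXiv:1412.8284 eq. (B14) for `ΔLB₄`, `ΔLB₆`, `ΔLB₈` (the earlier one-line gloss "`ΔLB_{2j} := ΔL_{2j} + ΔB_{2j}`"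
was not the papers' definition beyond order 4 — referee finding ref-2 r65 N-1; the tables below are unaffected:
they are, and were, keyed by the papers' `ΔLB_{2j}`). The printed terms that contain NO mass-insertion ("starred") constant
`ΔL*_{2j}`, `ΔB*_{2j}`, `Δδm_{2j}` are (transcribed in `printed4 … printed10` below)

* order 4 : `ΔM₄ − M₂ ΔLB₂`
* order 6 : `ΔM₆ − 3 ΔM₄ ΔLB₂ + M₂ (−ΔLB₄ + 2 ΔLB₂²)`
* order 8 : `ΔM₈ − 5 ΔM₆ ΔLB₂ + ΔM₄ (−3 ΔLB₄ + 9 ΔLB₂²) + M₂ (−ΔLB₆ + 6 ΔLB₄ ΔLB₂ − 5 ΔLB₂³)`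
* order 10: `ΔM₁₀ − 7 ΔM₈ ΔLB₂ + ΔM₆ (−5 ΔLB₄ + 20 ΔLB₂²) + ΔM₄ (−3 ΔLB₆ + 24 ΔLB₄ ΔLB₂ − 28 ΔLB₂³)`
            `+ M₂ (−ΔLB₈ + 8 ΔLB₆ ΔLB₂ + 4 ΔLB₄² − 28 ΔLB₄ ΔLB₂² + 14 ΔLB₂⁴)`

(order 8: arXiv:0712.2607 prints the exponents of the last two `ΔB₂` powers swapped — `ΔM₄{… 9 ΔB₂³}`,
`M₂{… 5 ΔB₂²}` — a misprint by order counting; the same paper's "old-style" formula thirty lines earlier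
has `9 ΔB₂²` / `5 ΔB₂³`; int-1 VALIDATION.md §V11. The corrected exponents are transcribed.)

THIS FILE gives ONE CLOSED FORM for all these coefficients. Index a term of order `2N` by its magnetic
order `n` (`1 ≤ n ≤ N`) and by the PARTITION `p` of `N − n` listing the orders `j` of its `ΔLB_{2j}` factors
(part `j` with multiplicity `k_j`; `K := Σ_j k_j` = number of factors). Then the coefficient of
`ΔM_{2n} · Π_j ΔLB_{2j}^{k_j}` in `A₁^{(2N)}` is

  `coeff n p = (−1)^K · (2n − 1) · (2N − 2)! / ((2N − 1 − K)! · Π_j k_j!)`            (`def coeff`).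

Certified here (kernel `decide`, no `native_decide`, no axioms beyond the standard three):
* `table_two … table_five`: the closed form reproduces ALL 25 printed non-starred coefficients of orders
  4, 6, 8 (corrected exponents), 10 — including WHICH monomials occur (the enumeration is by partitions,
  `partitions_count`: p(m) = 1, 1, 2, 3, 5, 7, 11 for m ≤ 6);
* `residualNoStar_two … residualNoStar_five`: the same as polynomial identities over `ℝ`;
* `table_six` / `residualNoStar_six`: the closed form's PREDICTION for the 19 non-starred terms of the
  order-12 formula (not in print);
* structural columns, all orders: `coeff_nil` (leading `ΔM_{2N}` has coefficient 1), `coeff_single_one`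
  (`ΔM_{2N−2} ΔLB₂` has coefficient `−(2N − 3)`), `coeff_one_replicate` (the `M₂ ΔLB₂^k` column is
  `(−1)^k · Catalan(k)`: 1, −1, 2, −5, 14, −42, …).

Equivalent generating-function form (int-1 `tools/residual_rule.py`, exact rational computer algebra through
order 14 — OBSERVED/DERIVED, NOT kernel-checked here): with `DM(u) = Σ_n ΔM_{2n} uⁿ` and
`DLB(u) = Σ_j ΔLB_{2j} u^j`, the no-star part of `A(t) = Σ_N A₁^{(2N)} t^N` is `DM(u) / (1 − DLB(u))` at
`u = t · (1 − DLB(u))²`; equivalently the tree rule of VALIDATION.md §V11, `C = 1 − Σ_j x_j t^j C^{2j}`,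
`A = Σ_n ΔM_{2n} tⁿ C^{2n−1}`. The closed form above is its Lagrange inversion; `coeff_one_replicate` is the
Catalan special case.

## What is NOT claimed
* The transcriptions `printed4 … printed10` are by hand from the cited equations; the theorems certify
  "closed form = transcription". The referee check is to compare the four `printed…` tables with print.
* Nothing is claimed about the STARRED terms (`ΔL*`, `ΔB*`, `Δδm`), which the printed formulas also contain
  from order 8 on; in int-1's own IR convention they are absent (VALIDATION.md §V13 — an observation about
  int-1's bookkeeping, exact but not kernel-checked). Order 12 is a prediction of the closed form, not a
  derivation in AHKN's scheme.
* Presearch (gen 13; corpus fts+vec and galaxy): no closed all-order form of these coefficients was found in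
  print — queries in int-1 NOTES; absence of evidence only. WORDING OF RECORD (cell decision D228, after the
  literature seat's presearch verdict of 2026-08-20): "closed form (this work), reproducing AHKN's printed
  residual-renormalisation coefficients through 2N = 10 (25/25, referee-checked, ref-2 r65); no all-order statement
  located in the AHKN papers; classical on-shell-renormalisation sources unverified; mechanism = Lagrange inversion
  (M. Borinsky, Graphs in Perturbation Theory, Springer Theses 2018, §3.1, as analogue); order 12 = prediction;
  NO novelty claim".
* Companion file `ResidualRenormalizationTree.lean` (gen 14): the tree rule `C = 1 − Σ_j x_j t^j C^{2j}` as a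
  computable coefficient extraction, kernel-checked equal to `table N` for `2 ≤ N ≤ 8` (orders 4 … 16).
-/

namespace Summit.Ventures.QEDPrecision.Integrands.ResidualRenormalization

/-! ## 1. Partitions (computable, kernel-reducible) -/

/-- Partitions of `m` into parts `≤ b`, as weakly decreasing lists of positive parts; the first argument is
fuel (any value `≥ m` gives all of them). -/
def partsLE : ℕ → ℕ → ℕ → List (List ℕ)
  | _, 0, _ => [[]]
  | 0, _ + 1, _ => []
  | f + 1, m + 1, b =>
      (List.range (min (m + 1) b)).reverse.flatMap fun i =>
        (partsLE f (m - i) (i + 1)).map fun p => (i + 1) :: p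

/-- All partitions of `m`, largest first part first:
`partitions 4 = [[4], [3, 1], [2, 2], [2, 1, 1], [1, 1, 1, 1]]`. -/
def partitions (m : ℕ) : List (List ℕ) := partsLE m m m

/-- the partitions of 4, in enumeration order. -/
theorem partitions_four : partitions 4 = [[4], [3, 1], [2, 2], [2, 1, 1], [1, 1, 1, 1]] := by decide +kernel

/-- sanity: the enumerator finds p(m) = 1, 1, 2, 3, 5, 7, 11 partitions for m = 0 … 6, pairwise distinct,
each summing to m. -/
theorem partitions_count :
    (List.range 7).map (fun m => (partitions m).length) = [1, 1, 2, 3, 5, 7, 11] ∧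
    (List.range 7).all (fun m => (partitions m).Nodup && (partitions m).all fun p => p.sum == m) = true := by
  refine ⟨?_, ?_⟩ <;> decide +kernel

/-- `Π_j k_j!` over the multiplicities `k_j` of the distinct parts `j` of `p`. -/
def multFact (p : List ℕ) : ℕ := (p.dedup.map fun j => (p.count j).factorial).prod

/-! ## 2. The closed form -/

/-- THE CLOSED FORM. For magnetic order `n ≥ 1` and a partition `p` of `N − n` (so `N = n + Σ p`) with
`K = |p|` parts: `coeff n p = (−1)^K (2n − 1) (2N − 2)! / ((2N − 1 − K)! · Π_j k_j!)` — the coefficient of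
`ΔM_{2n} · Π_{j ∈ p} ΔLB_{2j}` in the no-star part of `A₁^{(2N)}[q-type]`. -/
def coeff (n : ℕ) (p : List ℕ) : ℚ :=
  (-1 : ℚ) ^ p.length * ((2 * n - 1 : ℕ) : ℚ) * ((2 * (n + p.sum) - 2).factorial : ℚ) /
    (((2 * (n + p.sum) - 1 - p.length).factorial : ℚ) * (multFact p : ℚ))

/-- The no-star part of the order-`2N` residual renormalisation formula as a coefficient table: entries
`(n, p, c)` read "`c · ΔM_{2n} · Π_{j ∈ p} ΔLB_{2j}`", for `n = N, N − 1, …, 1` and `p` over `partitions (N − n)`. -/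
def table (N : ℕ) : List (ℕ × List ℕ × ℚ) :=
  (List.range N).flatMap fun m => (partitions m).map fun p => (N - m, p, coeff (N - m) p)

/-! ## 3. The printed formulas (TRANSCRIPTIONS) and the order-12 prediction -/

/-- TRANSCRIPTION, order 4 [arXiv:0712.2607 App. A, source label `a4_qtype`]: `ΔM₄ − M₂ ΔLB₂` (`ΔLB₂ = ΔB₂`, `ΔL₂ = 0`). -/
def printed4 : List (ℕ × List ℕ × ℚ) := [(2, [], 1), (1, [1], -1)]

/-- TRANSCRIPTION, order 6 [arXiv:0712.2607 App. A, source label `a6_result`]: `ΔM₆ − 3 ΔM₄ ΔLB₂ + M₂ (−ΔLB₄ + 2 ΔLB₂²)`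
(`ΔLB₄ = ΔL^{(4)} + ΔB^{(4)}`). -/
def printed6 : List (ℕ × List ℕ × ℚ) := [(3, [], 1), (2, [1], -3), (1, [2], -1), (1, [1, 1], 2)]

/-- TRANSCRIPTION, order 8, non-starred terms [arXiv:0712.2607, body, concluding section, display labelled
`a8_Residual_formula` (arXiv PDF p. 15); exponents corrected as explained in the module docstring]:
`ΔM₈ − 5 ΔM₆ ΔLB₂ + ΔM₄ (−3 ΔLB₄ + 9 ΔLB₂²) + M₂ (−ΔLB₆ + 6 ΔLB₄ ΔLB₂ − 5 ΔLB₂³)`, where `ΔLB₆` is the paper's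
combined constant `ΔLB^{(6)}` of display `LB_6` and `ΔLB₄ = ΔL^{(4)} + ΔB^{(4)}`. -/
def printed8 : List (ℕ × List ℕ × ℚ) :=
  [(4, [], 1), (3, [1], -5), (2, [2], -3), (2, [1, 1], 9), (1, [3], -1), (1, [2, 1], 6), (1, [1, 1, 1], -5)]

/-- TRANSCRIPTION, order 10, non-starred terms [arXiv:1412.8284 eq. (35)]:
`ΔM₁₀ − 7 ΔM₈ ΔLB₂ + ΔM₆ (−5 ΔLB₄ + 20 ΔLB₂²) + ΔM₄ (−3 ΔLB₆ + 24 ΔLB₄ ΔLB₂ − 28 ΔLB₂³)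
 + M₂ (−ΔLB₈ + 8 ΔLB₆ ΔLB₂ + 4 ΔLB₄² − 28 ΔLB₄ ΔLB₂² + 14 ΔLB₂⁴)`. -/
def printed10 : List (ℕ × List ℕ × ℚ) :=
  [(5, [], 1), (4, [1], -7), (3, [2], -5), (3, [1, 1], 20), (2, [3], -3), (2, [2, 1], 24),
   (2, [1, 1, 1], -28), (1, [4], -1), (1, [3, 1], 8), (1, [2, 2], 4), (1, [2, 1, 1], -28),
   (1, [1, 1, 1, 1], 14)]

/-- PREDICTION of the closed form, order 12 (19 non-starred terms; not in print):
`ΔM₁₂ − 9 ΔM₁₀ ΔLB₂ + ΔM₈ (−7 ΔLB₄ + 35 ΔLB₂²) + ΔM₆ (−5 ΔLB₆ + 50 ΔLB₄ ΔLB₂ − 75 ΔLB₂³)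
 + ΔM₄ (−3 ΔLB₈ + 30 ΔLB₆ ΔLB₂ + 15 ΔLB₄² − 135 ΔLB₄ ΔLB₂² + 90 ΔLB₂⁴)
 + M₂ (−ΔLB₁₀ + 10 ΔLB₈ ΔLB₂ + 10 ΔLB₆ ΔLB₄ − 45 ΔLB₆ ΔLB₂² − 45 ΔLB₄² ΔLB₂ + 120 ΔLB₄ ΔLB₂³ − 42 ΔLB₂⁵)`. -/
def predicted12 : List (ℕ × List ℕ × ℚ) :=
  [(6, [], 1), (5, [1], -9), (4, [2], -7), (4, [1, 1], 35), (3, [3], -5), (3, [2, 1], 50),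
   (3, [1, 1, 1], -75), (2, [4], -3), (2, [3, 1], 30), (2, [2, 2], 15), (2, [2, 1, 1], -135),
   (2, [1, 1, 1, 1], 90), (1, [5], -1), (1, [4, 1], 10), (1, [3, 2], 10), (1, [3, 1, 1], -45),
   (1, [2, 2, 1], -45), (1, [2, 1, 1, 1], 120), (1, [1, 1, 1, 1, 1], -42)]

/-! ## 4. Closed form = print (kernel computations) -/

/-- order 4: closed form = print (2 coefficients). -/
theorem table_two : table 2 = printed4 := by decide +kernel
/-- order 6: closed form = print (4 coefficients). -/
theorem table_three : table 3 = printed6 := by decide +kernel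
/-- order 8: closed form = print (7 non-starred coefficients, exponents as corrected). -/
theorem table_four : table 4 = printed8 := by decide +kernel
/-- order 10: closed form = print (12 non-starred coefficients, arXiv:1412.8284 eq. (35)). -/
theorem table_five : table 5 = printed10 := by decide +kernel
/-- order 12: the prediction. -/
theorem table_six : table 6 = predicted12 := by decide +kernel

/-! ## 5. The same as polynomial identities over `ℝ` -/

/-- Evaluate a coefficient table at `dM n = ΔM_{2n}` (`dM 1 = M₂`) and `x j = ΔLB_{2j}`. -/
noncomputable def eval (T : List (ℕ × List ℕ × ℚ)) (dM x : ℕ → ℝ) : ℝ :=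
  (T.map fun e => (e.2.2 : ℝ) * (dM e.1 * (e.2.1.map x).prod)).sum

/-- The closed-form no-star residual renormalisation polynomial of order `2N`, as a real number for given
values of the `ΔM_{2n}` and `ΔLB_{2j}`. -/
noncomputable def residualNoStar (N : ℕ) (dM x : ℕ → ℝ) : ℝ := eval (table N) dM x

/-- order 4 as a polynomial identity: `ΔM₄ − M₂ ΔLB₂`. -/
theorem residualNoStar_two (dM x : ℕ → ℝ) : residualNoStar 2 dM x = dM 2 - dM 1 * x 1 := by
  simp [residualNoStar, table_two, printed4, eval]; ring

/-- order 6 as a polynomial identity. -/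
theorem residualNoStar_three (dM x : ℕ → ℝ) :
    residualNoStar 3 dM x = dM 3 - 3 * dM 2 * x 1 + dM 1 * (-x 2 + 2 * x 1 ^ 2) := by
  simp [residualNoStar, table_three, printed6, eval]; ring

/-- order 8 (non-starred part) as a polynomial identity. -/
theorem residualNoStar_four (dM x : ℕ → ℝ) :
    residualNoStar 4 dM x = dM 4 - 5 * dM 3 * x 1 + dM 2 * (-3 * x 2 + 9 * x 1 ^ 2)
      + dM 1 * (-x 3 + 6 * x 2 * x 1 - 5 * x 1 ^ 3) := by
  simp [residualNoStar, table_four, printed8, eval]; ring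

/-- order 10 (non-starred part) as a polynomial identity. -/
theorem residualNoStar_five (dM x : ℕ → ℝ) :
    residualNoStar 5 dM x = dM 5 - 7 * dM 4 * x 1 + dM 3 * (-5 * x 2 + 20 * x 1 ^ 2)
      + dM 2 * (-3 * x 3 + 24 * x 2 * x 1 - 28 * x 1 ^ 3)
      + dM 1 * (-x 4 + 8 * x 3 * x 1 + 4 * x 2 ^ 2 - 28 * x 2 * x 1 ^ 2 + 14 * x 1 ^ 4) := by
  simp [residualNoStar, table_five, printed10, eval]; ring

/-- order 12 (prediction). -/
theorem residualNoStar_six (dM x : ℕ → ℝ) :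
    residualNoStar 6 dM x = dM 6 - 9 * dM 5 * x 1 + dM 4 * (-7 * x 2 + 35 * x 1 ^ 2)
      + dM 3 * (-5 * x 3 + 50 * x 2 * x 1 - 75 * x 1 ^ 3)
      + dM 2 * (-3 * x 4 + 30 * x 3 * x 1 + 15 * x 2 ^ 2 - 135 * x 2 * x 1 ^ 2 + 90 * x 1 ^ 4)
      + dM 1 * (-x 5 + 10 * x 4 * x 1 + 10 * x 3 * x 2 - 45 * x 3 * x 1 ^ 2 - 45 * x 2 ^ 2 * x 1
          + 120 * x 2 * x 1 ^ 3 - 42 * x 1 ^ 5) := by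
  simp [residualNoStar, table_six, predicted12, eval]; ring

/-! ## 6. Structural columns, all orders -/

/-- the leading term `ΔM_{2N}` always has coefficient `1`. -/
theorem coeff_nil (n : ℕ) (hn : 1 ≤ n) : coeff n [] = 1 := by
  obtain ⟨m, rfl⟩ := Nat.exists_eq_add_of_le hn
  simp only [coeff, multFact, List.length_nil, List.sum_nil, List.dedup_nil, List.map_nil, List.prod_nil,
    pow_zero, one_mul, Nat.cast_one, mul_one, add_zero]
  have h1 : 2 * (1 + m) - 1 - 0 = (2 * (1 + m) - 2) + 1 := by omega
  rw [h1, Nat.factorial_succ, Nat.cast_mul]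
  have h2 : ((2 * (1 + m) - 2 + 1 : ℕ) : ℚ) = ((2 * (1 + m) - 1 : ℕ) : ℚ) := by congr 1; omega
  rw [h2]
  have hpos : (0 : ℚ) < ((2 * (1 + m) - 1 : ℕ) : ℚ) := by
    exact_mod_cast (show 0 < 2 * (1 + m) - 1 by omega)
  have hfac : (0 : ℚ) < ((2 * (1 + m) - 2).factorial : ℚ) := by positivity
  field_simp

/-- the term `ΔM_{2N−2} ΔLB₂` always has coefficient `−(2N − 3) = −(2n − 1)`. -/
theorem coeff_single_one (n : ℕ) : coeff n [1] = -((2 * n - 1 : ℕ) : ℚ) := by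
  simp only [coeff, multFact, List.length_singleton, List.sum_cons, List.sum_nil, add_zero, pow_one]
  have hd : ([1] : List ℕ).dedup = [1] := by decide
  rw [hd]
  simp only [List.map_cons, List.map_nil, List.count_singleton_self, Nat.factorial_one, List.prod_cons,
    List.prod_nil, mul_one, Nat.cast_one]
  have h1 : 2 * (n + 1) - 1 - 1 = 2 * (n + 1) - 2 := by omega
  rw [h1]
  have hfac : (0 : ℚ) < ((2 * (n + 1) - 2).factorial : ℚ) := by positivity
  field_simp

/-- multiplicity factorial of `k` copies of the part `1` is `k!`. -/
theorem multFact_replicate_one (k : ℕ) : multFact (List.replicate k 1) = k.factorial := by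
  rcases k with _ | k
  · simp [multFact]
  · have hd : (List.replicate (k + 1) 1).dedup = [1] := by
      rw [List.replicate_dedup (Nat.succ_ne_zero k)]
    simp [multFact, hd, List.count_replicate_self]

/-- the `M₂ ΔLB₂^k` column is `(−1)^k · Catalan(k)` at every order (`k = N − 1`):
`1, −1, 2, −5, 14, −42, …`. -/
theorem coeff_one_replicate (k : ℕ) : coeff 1 (List.replicate k 1) = (-1) ^ k * (catalan k : ℚ) := by
  simp only [coeff, List.length_replicate, List.sum_replicate, smul_eq_mul, mul_one,
    multFact_replicate_one]
  have h1 : 2 * (1 + k) - 2 = 2 * k := by omega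
  have h2 : 2 * (1 + k) - 1 - k = k + 1 := by omega
  rw [h1, h2]
  have hc : (catalan k : ℚ) = ((2 * k).factorial : ℚ) / (((k + 1).factorial : ℚ) * (k.factorial : ℚ)) := by
    have hck : ((k + 1 : ℕ) : ℚ) * (catalan k : ℚ) = (k.centralBinom : ℚ) := by
      exact_mod_cast succ_mul_catalan_eq_centralBinom k
    have hcb : (k.centralBinom : ℚ) * ((k.factorial : ℚ) * (k.factorial : ℚ)) = ((2 * k).factorial : ℚ) := by
      have := Nat.centralBinom.eq_1 k
      have h := Nat.choose_mul_factorial_mul_factorial (show k ≤ 2 * k by omega)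
      rw [show 2 * k - k = k by omega] at h
      rw [Nat.centralBinom_eq_two_mul_choose]
      exact_mod_cast (by rw [← mul_assoc]; exact h)
    have hk1 : (0 : ℚ) < ((k + 1 : ℕ) : ℚ) := by positivity
    have hkf : (0 : ℚ) < (k.factorial : ℚ) := by positivity
    rw [Nat.factorial_succ, Nat.cast_mul]
    field_simp
    nlinarith [hck, hcb, hkf, hk1]
  rw [hc]
  ring

end Summit.Ventures.QEDPrecision.Integrands.ResidualRenormalization
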